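import Summits.BirchSwinnertonDyer.BirchSwinnertonDyer.Theorems.UniversalToricDescentToricTransportModThreeNormProfile
import Summits.BirchSwinnertonDyer.BirchSwinnertonDyer.Theorems.UniversalToricDescentBDPFrameCrossPeriodRigidity
import HarnessLib

/-!
# UTD crux #2, child `InvariantsTransportModThree` (stmt-BirchSwinnertonDyer-20399): the NORM PROFILE
# `(no coefficient of norm 1 below n, a coefficient of norm 1 at n)` of an element of `R₀⟦T⟧` is invariant
# under units, under change of generator of a principal ideal, and under change of BDP FRAME (any periods)

Lead prover bsd-wall-utd-p1 g3 (route `UniversalToricDescent`, `--supports stmt-BirchSwinnertonDyer-20399`).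
Child 20399 concludes, for every `R₀`-frame `L` of `f_E` (any non-zero periods), `∃ g n, Ch·R₀⟦T⟧ = (g) ∧
profileₙ(g) ∧ profileₙ(L)` where `profileₙ(x) :≡ (∀ i < n, ‖[T^i]x‖ < 1) ∧ ‖[T^n]x‖ = 1` (`μ(x) = 0`, `λ(x) = n`).
Its why-might-fail lists "compatible period normalisation of the two frames (LINE-STATUS Note A)". This file
removes that concern in the kernel: the profile is the same for ALL generators `g` of the ideal and for ALL frames
`L` — so 20399 costs exactly one generator and one frame.

* §1 (pure algebra in `R₀⟦T⟧ = UnrSeries p`, norm currency of `ℂ_p`) `norm_coeff_mul_lt_one_of_lt` (low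
  coefficients of `u·Q` stay of norm `< 1`), `norm_coeff_mul_eq_one_of_isUnit` (the first unit coefficient of
  `Q` survives multiplication by a unit `u`: leading term `u₀·Q_n`, ultrametric inequality),
  `normProfile_mul_of_isUnit`, `normProfile_iff_of_span_singleton_eq` (generators of the same principal ideal of
  the domain `R₀⟦T⟧` are associated).
* §2 `normProfile_iff_of_isBDPLFunction` — two `R₀`-frames of the same `(ι, 𝔭, κ, γ, f)` with ARBITRARY
  non-zero periods have the same profile at every `n` (utd-p2's integral cross-period rigidity
  `UniversalToricDescentTwinSplit.span_singleton_eq_of_isBDPLFunction`, any prime); and the 20399-shaped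
  corollary `invariantsTransport_conclusion_iff_of_isBDPLFunction`: the conclusion predicate of 20399 holds at
  one frame iff at any other.

THEOREMS ONLY; no definition (the profile is spelled out), no named fact, no `sorry`; imports no `Theses` module.
References: [GreenbergVatsal2000] R. Greenberg, V. Vatsal, Invent. Math. 142 (2000), §1 (the `(μ,λ)` currency);
[Washington1997] GTM 83, §7.1 (units of `A⟦T⟧`); [Castella2018] Thm. 3.1 (the frame).
-/

noncomputable section

open scoped Classical

set_option linter.dupNamespace false

namespace Summit.BirchSwinnertonDyer.BirchSwinnertonDyer.Theorems.UniversalToricDescentNormProfile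

open Literature.NumberTheory.EllipticCurves PowerSeries NumberField IsDedekindDomain

variable {p : ℕ} [Fact p.Prime]

/-! ### §1 Units and generators do not change the norm profile -/

/-- Low coefficients of a product stay small: if `‖[T^i]Q‖ < 1` for all `i < n`, then `‖[T^i](u·Q)‖ < 1` for all
`i < n` and ANY `u ∈ R₀⟦T⟧` (each term `u_j Q_k`, `k ≤ i < n`, has norm `< 1`; ultrametric inequality).
[folklore] -/
theorem norm_coeff_mul_lt_one_of_lt (u : UnrSeries p) {Q : UnrSeries p} {n : ℕ}
    (hQ : ∀ i < n, ‖((PowerSeries.coeff i Q : unrIntegers p) : ℂ_[p])‖ < 1) :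
    ∀ i < n, ‖((PowerSeries.coeff i (u * Q) : unrIntegers p) : ℂ_[p])‖ < 1 := by
  intro i hi
  let F : ℕ × ℕ → ℂ_[p] := fun jk ↦
    ((PowerSeries.coeff jk.1 u * PowerSeries.coeff jk.2 Q : unrIntegers p) : ℂ_[p])
  have hcoe : ((PowerSeries.coeff i (u * Q) : unrIntegers p) : ℂ_[p]) =
      ∑ jk ∈ Finset.HasAntidiagonal.antidiagonal i, F jk := by
    rw [PowerSeries.coeff_mul]
    exact map_sum (unrIntegers p).subtype _ _
  rw [hcoe]
  have hne : (Finset.HasAntidiagonal.antidiagonal i).Nonempty := ⟨(0, i), by simp⟩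
  obtain ⟨jk, hjk, hle⟩ := IsUltrametricDist.exists_norm_finsetSum_le_of_nonempty hne F
  refine lt_of_le_of_lt hle ?_
  rw [Finset.HasAntidiagonal.mem_antidiagonal] at hjk
  have hk : jk.2 < n := by omega
  simp only [F, Subring.coe_mul, norm_mul]
  calc ‖((PowerSeries.coeff jk.1 u : unrIntegers p) : ℂ_[p])‖ *
        ‖((PowerSeries.coeff jk.2 Q : unrIntegers p) : ℂ_[p])‖
      ≤ 1 * ‖((PowerSeries.coeff jk.2 Q : unrIntegers p) : ℂ_[p])‖ :=
        mul_le_mul_of_nonneg_right (norm_coeff_le_one u _) (norm_nonneg _)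
    _ < 1 := by rw [one_mul]; exact hQ _ hk

/-- The first unit coefficient survives multiplication by a unit: if `u` is a unit of `R₀⟦T⟧` (`‖u₀‖ = 1`),
`‖[T^i]Q‖ < 1` for `i < n` and `‖[T^n]Q‖ = 1`, then `‖[T^n](u·Q)‖ = 1` (the term `u₀ Q_n` has norm `1`, the
terms `u_{n-k} Q_k`, `k < n`, have norm `< 1`). [folklore] -/
theorem norm_coeff_mul_eq_one_of_isUnit {u Q : UnrSeries p} (hu : IsUnit u) {n : ℕ}
    (hQ : ∀ i < n, ‖((PowerSeries.coeff i Q : unrIntegers p) : ℂ_[p])‖ < 1)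
    (hQn : ‖((PowerSeries.coeff n Q : unrIntegers p) : ℂ_[p])‖ = 1) :
    ‖((PowerSeries.coeff n (u * Q) : unrIntegers p) : ℂ_[p])‖ = 1 := by
  have hu0 : ‖((PowerSeries.constantCoeff u : unrIntegers p) : ℂ_[p])‖ = 1 :=
    (unrIntegers.isUnit_iff_norm_eq_one _).mp (PowerSeries.isUnit_constantCoeff u hu)
  let F : ℕ × ℕ → ℂ_[p] := fun kj ↦
    ((PowerSeries.coeff kj.1 Q * PowerSeries.coeff kj.2 u : unrIntegers p) : ℂ_[p])
  have hcoe : ((PowerSeries.coeff n (u * Q) : unrIntegers p) : ℂ_[p]) =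
      ∑ kj ∈ Finset.HasAntidiagonal.antidiagonal n, F kj := by
    rw [mul_comm u Q, PowerSeries.coeff_mul]
    exact map_sum (unrIntegers p).subtype _ _
  have hmem : ((n, 0) : ℕ × ℕ) ∈ Finset.HasAntidiagonal.antidiagonal n := by simp
  rw [hcoe, ← Finset.add_sum_erase _ _ hmem]
  have hlead : ‖F (n, 0)‖ = 1 := by
    simp only [F, Subring.coe_mul, norm_mul, PowerSeries.coeff_zero_eq_constantCoeff_apply]
    rw [hQn, hu0, one_mul]
  have hrest : ‖∑ kj ∈ (Finset.HasAntidiagonal.antidiagonal n).erase (n, 0), F kj‖ < 1 := by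
    rcases ((Finset.HasAntidiagonal.antidiagonal n).erase (n, 0)).eq_empty_or_nonempty with h0 | hne
    · rw [h0, Finset.sum_empty, norm_zero]; exact zero_lt_one
    · obtain ⟨kj, hkj, hle⟩ := IsUltrametricDist.exists_norm_finsetSum_le_of_nonempty hne F
      refine lt_of_le_of_lt hle ?_
      rw [Finset.mem_erase, Finset.HasAntidiagonal.mem_antidiagonal] at hkj
      have hk : kj.1 < n := by
        rcases Nat.lt_or_ge kj.1 n with h | h
        · exact h
        · exfalso
          exact hkj.1 (Prod.ext (by omega) (by omega))
      simp only [F, Subring.coe_mul, norm_mul]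
      calc ‖((PowerSeries.coeff kj.1 Q : unrIntegers p) : ℂ_[p])‖ *
            ‖((PowerSeries.coeff kj.2 u : unrIntegers p) : ℂ_[p])‖
          ≤ ‖((PowerSeries.coeff kj.1 Q : unrIntegers p) : ℂ_[p])‖ * 1 :=
            mul_le_mul_of_nonneg_left (norm_coeff_le_one u _) (norm_nonneg _)
        _ < 1 := by rw [mul_one]; exact hQ _ hk
  rw [IsUltrametricDist.norm_add_eq_max_of_norm_ne_norm (by rw [hlead]; exact hrest.ne'), hlead,
    max_eq_left hrest.le]

/-- **The norm profile is invariant under units of `R₀⟦T⟧`**: `profileₙ(Q) ⟹ profileₙ(u·Q)` for a unit `u`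
(so `μ` and `λ` of `Q` and `u·Q` agree). [cite: Washington1997, §7.1 (units of A⟦T⟧; μ, λ of associates)] -/
theorem normProfile_mul_of_isUnit {u Q : UnrSeries p} (hu : IsUnit u) {n : ℕ}
    (hQ : (∀ i < n, ‖((PowerSeries.coeff i Q : unrIntegers p) : ℂ_[p])‖ < 1) ∧
      ‖((PowerSeries.coeff n Q : unrIntegers p) : ℂ_[p])‖ = 1) :
    (∀ i < n, ‖((PowerSeries.coeff i (u * Q) : unrIntegers p) : ℂ_[p])‖ < 1) ∧
      ‖((PowerSeries.coeff n (u * Q) : unrIntegers p) : ℂ_[p])‖ = 1 :=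
  ⟨norm_coeff_mul_lt_one_of_lt u hQ.1, norm_coeff_mul_eq_one_of_isUnit hu hQ.1 hQ.2⟩

/-- **Two generators of the same principal ideal of `R₀⟦T⟧` have the same norm profile** (they are associated;
`R₀⟦T⟧` is a domain). [cite: Washington1997, §7.1 (units of A⟦T⟧; μ, λ of associates)] -/
theorem normProfile_iff_of_span_singleton_eq {Q Q' : UnrSeries p}
    (h : Ideal.span ({Q} : Set (UnrSeries p)) = Ideal.span {Q'}) (n : ℕ) :
    ((∀ i < n, ‖((PowerSeries.coeff i Q : unrIntegers p) : ℂ_[p])‖ < 1) ∧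
        ‖((PowerSeries.coeff n Q : unrIntegers p) : ℂ_[p])‖ = 1) ↔
      ((∀ i < n, ‖((PowerSeries.coeff i Q' : unrIntegers p) : ℂ_[p])‖ < 1) ∧
        ‖((PowerSeries.coeff n Q' : unrIntegers p) : ℂ_[p])‖ = 1) := by
  obtain ⟨v, hv⟩ := Ideal.span_singleton_eq_span_singleton.mp h
  constructor
  · intro hQ
    rw [← hv, mul_comm]
    exact normProfile_mul_of_isUnit v.isUnit hQ
  · intro hQ'
    have hQ : Q = ((v⁻¹ : (UnrSeries p)ˣ) : UnrSeries p) * Q' := by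
      rw [← hv, mul_comm Q, ← mul_assoc, Units.inv_mul, one_mul]
    rw [hQ]
    exact normProfile_mul_of_isUnit (v⁻¹).isUnit hQ'

/-! ### §2 The profile does not see the frame -/

section Frame

variable {K : Type} [Field K] [NumberField K] {N : ℕ} {ι : PadicAlgCl p ≃+* ℂ}
  {𝔭 : HeightOneSpectrum (𝓞 K)} {κ : ZpExtension K p} {γ : Field.absoluteGaloisGroup K}
  {f : CuspForm (CongruenceSubgroup.Gamma0 N) 2} {ΩK ΩK' : ℂ} {Ωp Ωp' : ℂ_[p]} {L L' : UnrSeries p}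

/-- **Two `R₀`-frames of the same `(ι, 𝔭, κ, γ, f)` — ARBITRARY non-zero periods — have the same norm profile at
every `n`** (`K` imaginary quadratic, `κ` anticyclotomic, `γ` a topological generator; any prime `p`): they
generate the same ideal by utd-p2's integral cross-period rigidity
`UniversalToricDescentTwinSplit.span_singleton_eq_of_isBDPLFunction`, and §1 applies. So in child 20399 the
∀-frame quantification of the conclusion costs ONE frame ("Note A" of its why-might-fail is void).
[cite: Castella2018, Thm. 3.1 (arXiv:1704.06608 p. 9)] [cite: GreenbergVatsal2000, §1 (the (μ, λ) currency)] -/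
theorem normProfile_iff_of_isBDPLFunction (hK : IsImaginaryQuadratic K) (hκ : κ.IsAnticyclotomic)
    (hγ : κ.IsTopGenerator γ) (hΩK : ΩK ≠ 0) (hΩK' : ΩK' ≠ 0) (hΩp : Ωp ≠ 0) (hΩp' : Ωp' ≠ 0)
    (hL : IsBDPLFunction ι 𝔭 κ γ f ΩK Ωp L) (hL' : IsBDPLFunction ι 𝔭 κ γ f ΩK' Ωp' L') (n : ℕ) :
    ((∀ i < n, ‖((PowerSeries.coeff i L : unrIntegers p) : ℂ_[p])‖ < 1) ∧
        ‖((PowerSeries.coeff n L : unrIntegers p) : ℂ_[p])‖ = 1) ↔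
      ((∀ i < n, ‖((PowerSeries.coeff i L' : unrIntegers p) : ℂ_[p])‖ < 1) ∧
        ‖((PowerSeries.coeff n L' : unrIntegers p) : ℂ_[p])‖ = 1) :=
  normProfile_iff_of_span_singleton_eq
    (UniversalToricDescentTwinSplit.span_singleton_eq_of_isBDPLFunction hK hκ hγ hΩK hΩK' hΩp hΩp'
      hL hL').symm n

/-- **The conclusion predicate of child 20399 `InvariantsTransportModThree` is FRAME-INDEPENDENT**: for an ideal
`I` of `R₀⟦T⟧` (in 20399: `Ch_Λ(X_{∅,0}(E/K_∞))·R₀⟦T⟧`) and two `R₀`-frames `L, L'` of the same `(ι, 𝔭, κ, γ, f)`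
with arbitrary non-zero periods,
`(∃ g n, I = (g) ∧ profileₙ(g) ∧ profileₙ(L)) ↔ (∃ g n, I = (g) ∧ profileₙ(g) ∧ profileₙ(L'))`.
[cite: Castella2018, Thm. 3.1 (arXiv:1704.06608 p. 9)] [cite: GreenbergVatsal2000, §1 (the (μ, λ) currency)] -/
theorem invariantsTransport_conclusion_iff_of_isBDPLFunction (I : Ideal (UnrSeries p))
    (hK : IsImaginaryQuadratic K) (hκ : κ.IsAnticyclotomic) (hγ : κ.IsTopGenerator γ) (hΩK : ΩK ≠ 0)
    (hΩK' : ΩK' ≠ 0) (hΩp : Ωp ≠ 0) (hΩp' : Ωp' ≠ 0) (hL : IsBDPLFunction ι 𝔭 κ γ f ΩK Ωp L)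
    (hL' : IsBDPLFunction ι 𝔭 κ γ f ΩK' Ωp' L') :
    (∃ (g : UnrSeries p) (n : ℕ), I = Ideal.span {g} ∧
        (∀ i < n, ‖((PowerSeries.coeff i g : unrIntegers p) : ℂ_[p])‖ < 1) ∧
        ‖((PowerSeries.coeff n g : unrIntegers p) : ℂ_[p])‖ = 1 ∧
        (∀ i < n, ‖((PowerSeries.coeff i L : unrIntegers p) : ℂ_[p])‖ < 1) ∧
        ‖((PowerSeries.coeff n L : unrIntegers p) : ℂ_[p])‖ = 1) ↔
      (∃ (g : UnrSeries p) (n : ℕ), I = Ideal.span {g} ∧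
        (∀ i < n, ‖((PowerSeries.coeff i g : unrIntegers p) : ℂ_[p])‖ < 1) ∧
        ‖((PowerSeries.coeff n g : unrIntegers p) : ℂ_[p])‖ = 1 ∧
        (∀ i < n, ‖((PowerSeries.coeff i L' : unrIntegers p) : ℂ_[p])‖ < 1) ∧
        ‖((PowerSeries.coeff n L' : unrIntegers p) : ℂ_[p])‖ = 1) := by
  constructor
  · rintro ⟨g, n, hI, hg, hgn, hLl, hLn⟩
    have h := (normProfile_iff_of_isBDPLFunction hK hκ hγ hΩK hΩK' hΩp hΩp' hL hL' n).mp ⟨hLl, hLn⟩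
    exact ⟨g, n, hI, hg, hgn, h.1, h.2⟩
  · rintro ⟨g, n, hI, hg, hgn, hLl, hLn⟩
    have h := (normProfile_iff_of_isBDPLFunction hK hκ hγ hΩK hΩK' hΩp hΩp' hL hL' n).mpr ⟨hLl, hLn⟩
    exact ⟨g, n, hI, hg, hgn, h.1, h.2⟩

/-- **… and GENERATOR-INDEPENDENT**: if `I = (g) = (g')` then `profileₙ(g) ↔ profileₙ(g')`; hence the `∃ g` in
20399's conclusion may be read on ANY generator of `Ch·R₀⟦T⟧`. [cite: Washington1997, §7.1] -/
theorem normProfile_iff_of_generators {I : Ideal (UnrSeries p)} {g g' : UnrSeries p}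
    (hg : I = Ideal.span {g}) (hg' : I = Ideal.span {g'}) (n : ℕ) :
    ((∀ i < n, ‖((PowerSeries.coeff i g : unrIntegers p) : ℂ_[p])‖ < 1) ∧
        ‖((PowerSeries.coeff n g : unrIntegers p) : ℂ_[p])‖ = 1) ↔
      ((∀ i < n, ‖((PowerSeries.coeff i g' : unrIntegers p) : ℂ_[p])‖ < 1) ∧
        ‖((PowerSeries.coeff n g' : unrIntegers p) : ℂ_[p])‖ = 1) :=
  normProfile_iff_of_span_singleton_eq (hg.symm.trans hg') n

end Frame

end Summit.BirchSwinnertonDyer.BirchSwinnertonDyer.Theorems.UniversalToricDescentNormProfile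

end
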